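import Summits.Ventures.HSemireg.WedgeHankelRecurrenceWaringCensus

/-!
# Venture HSemireg — A SHORT REPRESENTATION CONTAINS A MINIMAL ONE, and THE CENSUS OF THE GAP: over ANY field, if a class `q` on `[0, N]` of middle rank `r` (`2r ≤ N + 1`) is a sum of
# `t ≤ N + 1 − r` geometric sequences with distinct nodes `λ_i ∈ K`, then **`r` of those nodes already suffice** (the minimal recurrence splits among them, N61, and Prony resynthesises);
# so the representations of `q` have either `≥ N + 2 − r` terms only, or one with exactly `r` terms; over a field with `s` elements **exactly `(s² − 1)s^{2r−2} − C(s, r)(s − 1)^r` classes of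
# rank `r` are in the first case** (N44's census minus N65's Waring census)

HONEST FRAMING. Part of the Lean index of the computation cell `pub-hsemireg` (seat p10 gen 30, Sunday typer «UNIFORM-IN-n»).
LINEAR ALGEBRA OF HANKEL (catalecticant) MATRICES and of polynomials over a field ONLY: no variety, no cohomology theory, no sheaf, no Ext group and no semiregularity map is constructed
here; nothing here says that HC / HC_CM / HC_AV holds; no Literature fact is declared or used.  Custodian versions as in `WedgeHankelSiegelIdeal` (1/3); the dictionary («Waring rank of a binary
form over a finite ∕ arbitrary field, nodes required rational») is QUOTED in docstrings, never asserted.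

WHAT IS IN THE TREE.  N65 (`WedgeHankelRecurrenceWaringCensus`, № 409): `exists_secSeq_iff_exists_finset`, `ncard_setOf_exists_secSeq` (`C(s, r)(s − 1)^r`); N61 (№ 391):
`natDegree_eq_and_dvd_of_secSeq_agree`, `separable_of_secSeq_agree`, `prod_X_sub_C_mem_recSpace_of_secSeq_agree`, `rank_le_of_secSeq_agree`; N44 (№ 326) `ncard_setOf_rank_half_eq` (`(s² − 1)s^{2r−2}`),
`seqOf`; N23 (№ 176) `exists_secSeq_of_prod_X_sub_C_mem_recSpace`; N19 (№ 174) `prod_X_sub_C_nodes_ne_zero`; N18 (№ 173) `exists_recSpace_self_eq_span`.  Mathlib: `Polynomial.Splits.prod`,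
`Splits.X_sub_C`, `Splits.of_dvd`, `Splits.eq_prod_roots`, `Splits.natDegree_eq_card_roots`, `Polynomial.roots.le_of_dvd`, `Polynomial.roots_prod` / `roots_X_sub_C` / `Multiset.bind_singleton`,
`rootMultiplicity_le_one_of_separable`, `count_roots`, `Multiset.nodup_iff_count_le_one`, `Set.ncard_sdiff'`.
THIS FILE (namespace `Summit.Ventures.HSemireg.Wedge.HankelOuter` continued; PLAIN on N65; 0 definitions):
* §615 (every field) `exists_eq_C_mul_prod_X_sub_C_of_splits` (a SPLIT polynomial of degree `d` with simple roots is `lc·∏_{i<d} (X − λ_i)`, `λ` injective, `λ_i` among its roots);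
  **`exists_secSeq_agree_self_of_secSeq_agree`** (A SHORT REPRESENTATION CONTAINS A MINIMAL ONE: `R^N(q) = r`, `2r ≤ N + 1`, a `t`-term representation with `t + r ≤ N + 1 ⇒` an `r`-term
  representation on a SUBSET of its nodes); **`exists_secSeq_agree_lt_iff`** (a representation with fewer than `N + 2 − r` terms exists iff one with exactly `r` terms does);
  `forall_le_add_iff_not_exists` (every representation has `≥ N + 2 − r` terms iff there is no `r`-term one).
* §616 (finite field, `s = #K`) **`ncard_setOf_rank_eq_and_forall_le_add`** (THE CENSUS OF THE GAP: `#{v | R^N(v) = r ∧ every representation of v has ≥ N + 2 − r terms}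
  = (s² − 1)s^{2r−2} − C(s, r)(s − 1)^r`, `1 ≤ r`, `2r ≤ N + 1`).
CAVEAT.  Over a finite field a class in the gap need NOT have an `(N + 2 − r)`-term representation at all (too few rational nodes); the count is of classes WITHOUT a short one.  Nothing Ext-side.
New names only.
-/

open Module Polynomial
open scoped Matrix Polynomial

namespace Summit.Ventures.HSemireg.Wedge.HankelOuter

open Summit.Ventures.HSemireg.Wedge Summit.Ventures.HSemireg.Wedge.Hankel Summit.Ventures.HSemireg.Wedge.HankelSecant

variable (K : Type*) [Field K] {N : ℕ}

/-! ## §615. A short representation contains a minimal one -/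

variable {K}

/-- **a SPLIT polynomial of degree `d` whose roots are simple is `lc(p) · ∏_{i<d} (X − λ_i)` with DISTINCT `λ_i`, each a root of `p`** (every field). -/
theorem exists_eq_C_mul_prod_X_sub_C_of_splits {p : K[X]} {d : ℕ} (hsp : p.Splits) (hpd : p.natDegree = d) (hmult : ∀ x, p.rootMultiplicity x ≤ 1) :
    ∃ lam : Fin d → K, Function.Injective lam ∧ (∀ i, lam i ∈ p.roots) ∧ p = C p.leadingCoeff * ∏ i, (Polynomial.X - C (lam i)) := by
  classical
  have hnd : p.roots.Nodup := Multiset.nodup_iff_count_le_one.mpr fun x => by rw [count_roots]; exact hmult x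
  have hcard : p.roots.toFinset.card = d := by rw [Multiset.toFinset_card_of_nodup hnd, ← hsp.natDegree_eq_card_roots, hpd]
  let e := p.roots.toFinset.equivFin.trans (finCongr hcard)
  refine ⟨fun i => (e.symm i : K), fun i j h => e.symm.injective (Subtype.ext h), fun i => Multiset.mem_toFinset.mp (e.symm i).2, ?_⟩
  have hprod : (∏ i : Fin d, (Polynomial.X - C ((e.symm i : K)))) = ∏ x ∈ p.roots.toFinset, (Polynomial.X - C x) := by
    rw [← Finset.prod_coe_sort p.roots.toFinset]
    exact Fintype.prod_equiv e.symm _ (fun x => Polynomial.X - C (x : K)) fun i => rfl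
  rw [hprod, Finset.prod_eq_multiset_prod, Multiset.toFinset_val, Multiset.dedup_eq_self.mpr hnd]
  exact hsp.eq_prod_roots

/-- the product `∏_{i<t} (X − λ_i)` splits, with root multiset `{λ_i}`. -/
theorem splits_prod_X_sub_C_nodes {t : ℕ} (lam : Fin t → K) :
    (∏ i, (Polynomial.X - C (lam i))).Splits ∧ (∏ i, (Polynomial.X - C (lam i))).roots = (Finset.univ.val : Multiset (Fin t)).map lam := by
  refine ⟨Splits.prod fun i _ => Splits.X_sub_C (lam i), ?_⟩
  rw [roots_prod _ _ (prod_X_sub_C_nodes_ne_zero K lam)]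
  simp_rw [roots_X_sub_C]
  exact Multiset.bind_singleton _ _

variable (K)

/-- **A SHORT REPRESENTATION CONTAINS A MINIMAL ONE (every field): if `q` with `R^N(q) = r`, `2r ≤ N + 1` is `q_j = Σ_{i<t} A_i λ_i^j` on `[0, N]` with distinct `λ_i ∈ K` and
`t + r ≤ N + 1`, then `q_j = Σ_{k<r} A′_k μ_k^j` on `[0, N]` for `r` DISTINCT nodes `μ_k` taken AMONG the `λ_i`** (the minimal recurrence divides `∏ (X − λ_i)` with `deg = r` (N61), so it
splits with simple roots among the `λ_i`; Prony synthesis N23 on those roots). -/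
theorem exists_secSeq_agree_self_of_secSeq_agree {r t : ℕ} {q : ℕ → K} (hq : (hankel1 K N (N / 2) q).rank = r) (h2 : r + r ≤ N + 1) {lam A : Fin t → K} (hlam : Function.Injective lam)
    (ht : t + r ≤ N + 1) (hrep : ∀ j ≤ N, q j = secSeq K A lam j) :
    ∃ (mu A' : Fin r → K), Function.Injective mu ∧ Set.range mu ⊆ Set.range lam ∧ ∀ j ≤ N, q j = secSeq K A' mu j := by
  obtain ⟨m, hm0, hspan⟩ := exists_recSpace_self_eq_span K hq h2
  have hm : m ∈ recSpace K N q r := by rw [hspan]; exact Submodule.mem_span_singleton_self m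
  obtain ⟨hdeg, hdvd⟩ := natDegree_eq_and_dvd_of_secSeq_agree K hq hm hm0 hlam ht hrep
  obtain ⟨hPsp, hProots⟩ := splits_prod_X_sub_C_nodes lam
  have hsp : m.Splits := hPsp.of_dvd (prod_X_sub_C_nodes_ne_zero K lam) hdvd
  obtain ⟨mu, hmu, hmuroots, hprod⟩ := exists_eq_C_mul_prod_X_sub_C_of_splits hsp hdeg (rootMultiplicity_le_one_of_separable (separable_of_secSeq_agree K hq hm hm0 hlam ht hrep))
  have hle : m.roots ≤ (∏ i, (Polynomial.X - C (lam i))).roots := roots.le_of_dvd (prod_X_sub_C_nodes_ne_zero K lam) hdvd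
  -- every `μ_k` is among the `λ_i`
  have hrange : Set.range mu ⊆ Set.range lam := by
    rintro x ⟨k, rfl⟩
    have hx : mu k ∈ (∏ i, (Polynomial.X - C (lam i))).roots := Multiset.mem_of_le hle (hmuroots k)
    rw [hProots, Multiset.mem_map] at hx
    obtain ⟨i, -, hi⟩ := hx
    exact ⟨i, hi⟩
  -- weights by Prony on the roots of `m`
  have hmem : (∏ k, (Polynomial.X - C (mu k))) ∈ recSpace K N q r := by
    have hlc : m.leadingCoeff ≠ 0 := leadingCoeff_ne_zero.mpr hm0
    have h1 : (∏ k, (Polynomial.X - C (mu k))) = C m.leadingCoeff⁻¹ * m :=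
      calc (∏ k, (Polynomial.X - C (mu k))) = C m.leadingCoeff⁻¹ * (C m.leadingCoeff * ∏ k, (Polynomial.X - C (mu k))) := by
            rw [← mul_assoc, ← C_mul, inv_mul_cancel₀ hlc, C_1, one_mul]
        _ = C m.leadingCoeff⁻¹ * m := by rw [← hprod]
    rw [h1, Polynomial.C_mul']
    exact Submodule.smul_mem _ _ hm
  obtain ⟨A', hA'⟩ := exists_secSeq_of_prod_X_sub_C_mem_recSpace K hmu hmem
  exact ⟨mu, A', hmu, hrange, hA'⟩

/-- **A REPRESENTATION WITH FEWER THAN `N + 2 − r` TERMS EXISTS IFF ONE WITH EXACTLY `r` TERMS DOES** (`R^N(q) = r`, `2r ≤ N + 1`, nodes in `K`, every field). -/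
theorem exists_secSeq_agree_lt_iff {r : ℕ} {q : ℕ → K} (hq : (hankel1 K N (N / 2) q).rank = r) (h2 : r + r ≤ N + 1) :
    (∃ t, t + r ≤ N + 1 ∧ ∃ (lam A : Fin t → K), Function.Injective lam ∧ ∀ j ≤ N, q j = secSeq K A lam j)
      ↔ ∃ (mu A : Fin r → K), Function.Injective mu ∧ ∀ j ≤ N, q j = secSeq K A mu j := by
  constructor
  · rintro ⟨t, ht, lam, A, hlam, hrep⟩
    obtain ⟨mu, A', hmu, -, hrep'⟩ := exists_secSeq_agree_self_of_secSeq_agree K hq h2 hlam ht hrep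
    exact ⟨mu, A', hmu, hrep'⟩
  · rintro ⟨mu, A, hmu, hrep⟩
    exact ⟨r, h2, mu, A, hmu, hrep⟩

/-- **… so EVERY representation has at least `N + 2 − r` terms iff there is NO `r`-term representation.** -/
theorem forall_le_add_iff_not_exists {r : ℕ} {q : ℕ → K} (hq : (hankel1 K N (N / 2) q).rank = r) (h2 : r + r ≤ N + 1) :
    (∀ (t : ℕ) (lam A : Fin t → K), Function.Injective lam → (∀ j ≤ N, q j = secSeq K A lam j) → N + 2 ≤ t + r)
      ↔ ¬ ∃ (mu A : Fin r → K), Function.Injective mu ∧ ∀ j ≤ N, q j = secSeq K A mu j := by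
  rw [← exists_secSeq_agree_lt_iff K hq h2]
  constructor
  · rintro h ⟨t, ht, lam, A, hlam, hrep⟩
    have := h t lam A hlam hrep
    omega
  · intro h t lam A hlam hrep
    by_contra hlt
    exact h ⟨t, by omega, lam, A, hlam, hrep⟩

/-! ## §616. The census of the gap over a finite field -/

/-- **THE CENSUS OF THE GAP: over a field with `s` elements, for `1 ≤ r`, `2r ≤ N + 1`, exactly `(s² − 1)s^{2r−2} − C(s, r)(s − 1)^r` classes `v` on `[0, N]` of middle rank `r` have NO
representation `v_j = Σ_{i<t} A_i λ_i^j` (`j ≤ N`, distinct `λ_i ∈ K`) with fewer than `N + 2 − r` terms** (N44's `(s² − 1)s^{2r−2}` classes of rank `r` minus N65's `C(s, r)(s − 1)^r` honest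
`r`-term sums; by §615 nothing lies in between). -/
theorem ncard_setOf_rank_eq_and_forall_le_add [Finite K] {r : ℕ} (hr : 1 ≤ r) (h2 : r + r ≤ N + 1) :
    {v : Fin (N + 1) → K | (hankel1 K N (N / 2) (seqOf K v)).rank = r ∧
        ∀ (t : ℕ) (lam A : Fin t → K), Function.Injective lam → (∀ j ≤ N, seqOf K v j = secSeq K A lam j) → N + 2 ≤ t + r}.ncard
      = (Nat.card K ^ 2 - 1) * Nat.card K ^ (2 * r - 2) - (Nat.card K).choose r * (Nat.card K - 1) ^ r := by
  rw [← ncard_setOf_rank_half_eq K hr h2, ← ncard_setOf_exists_secSeq K h2]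
  have hsub : {v : Fin (N + 1) → K | ∃ (lam A : Fin r → K), Function.Injective lam ∧ (∀ i, A i ≠ 0) ∧ ∀ j ≤ N, seqOf K v j = secSeq K A lam j}
      ⊆ {v : Fin (N + 1) → K | (hankel1 K N (N / 2) (seqOf K v)).rank = r} := fun v hv =>
    ((exists_secSeq_iff_exists_finset K h2 (seqOf K v)).mp hv).1
  rw [← Set.ncard_sdiff' hsub (Set.toFinite _)]
  refine congrArg Set.ncard (Set.ext fun v => ?_)
  simp only [Set.mem_setOf_eq, Set.mem_sdiff]
  constructor
  · rintro ⟨hR, hall⟩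
    refine ⟨hR, ?_⟩
    rintro ⟨lam, A, hlam, -, hrep⟩
    have := hall r lam A hlam hrep
    omega
  · rintro ⟨hR, hno⟩
    refine ⟨hR, (forall_le_add_iff_not_exists K hR h2).mpr ?_⟩
    rintro ⟨mu, A, hmu, hrep⟩
    -- an `r`-term representation of a rank-`r` class has non-zero weights (N65's reading)
    classical
    have hfin : (hankel1 K N (N / 2) (seqOf K v)).rank = r ∧ ∃ S : Finset K, S.card = r ∧ (∏ x ∈ S, (Polynomial.X - C x)) ∈ recSpace K N (seqOf K v) r := by
      refine ⟨hR, Finset.univ.image mu, by rw [Finset.card_image_of_injective _ hmu, Finset.card_univ, Fintype.card_fin], ?_⟩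
      rw [Finset.prod_image fun i _ j _ h => hmu h]
      exact prod_X_sub_C_mem_recSpace_of_secSeq_agree K hmu hrep
    exact hno ((exists_secSeq_iff_exists_finset K h2 (seqOf K v)).mpr hfin)

end Summit.Ventures.HSemireg.Wedge.HankelOuter
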